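import Literature.NumberTheory.LFunctions.ClassGroupSmoothedSums
import Literature.NumberTheory.LFunctions.ClassGroupLFunctionEntire
import Literature.NumberTheory.LFunctions.ClassGroupLFunctionInversion
import HarnessLib

/-!
# Smoothed sums over an ideal class and over the multiples of an ideal (Thorner–Zaman 2017, Cor. 4.5)

Topic `Literature/NumberTheory/LFunctions`, namespace `Literature.NumberTheory.LFunctions.NumberField`.
Everything here is PROVED (one definition with body, theorems; no named facts).

With Weiss's kernel `φ = φ_{m+1}` (parameter `A`) and `u = log x` put, for a class `C ∈ Cl_K`,
`S_C(u) = Σ_{𝔫 ∈ C} N𝔫^{−1} φ(u − log N𝔫)` (`classSmoothedSum`).  By orthogonality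
`S_C(u) = h⁻¹ Σ_χ χ̄(C) S_χ(u)` with the character sums `S_χ` of `ClassGroupSmoothedSums.lean`, so that
`ClassGroupSmoothedSums.norm_smoothedClassSum_sub_le` gives

* `norm_classSmoothedSum_sub_le` — **`|S_C(u) − κ_K/h| ≤ (1/3)|d_K|e^{2n_K} C e^{−3u/2}`**
  (`κ_K/h = E(1)`, the class-independent residue of the partial zeta functions,
  `classSumEntire_one_eq`; `C = majorConst A m (n_K+1)`, `m ≥ n_K + 3`);
* `tsum_dvd_classSmoothedSum_eq` — for a nonzero ideal `𝔡`,
  `Σ_{𝔫 ∈ C, 𝔡 ∣ 𝔫} N𝔫^{−1} φ(u − log N𝔫) = N𝔡^{−1} S_{C[𝔡]⁻¹}(u − log N𝔡)` (`𝔫 = 𝔡𝔪`);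
* `norm_tsum_dvd_sub_le` — **Thorner–Zaman Cor. 4.5 for the class group**:
  `|Σ_{𝔫 ∈ C, 𝔡 ∣ 𝔫} N𝔫^{−1} φ(u − log N𝔫) − κ_K/(h N𝔡)| ≤ (1/3)|d_K|e^{2n_K} C e^{−3u/2} N𝔡^{1/2}`,
  the input of the Selberg sieve (TZ Lemma 4.6).

## References

* [ThornerZaman2017] J. Thorner, A. Zaman, *An explicit bound for the least prime ideal in the
  Chebotarev density theorem*, Algebra Number Theory 11 (2017), Lemma 4.4, Corollary 4.5.
* [Weiss1983] A. Weiss, *The least prime ideal*, J. reine angew. Math. 338 (1983), Lemma 3.4,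
  Corollary 3.5.
-/

noncomputable section

open MeasureTheory Real Complex Set Filter Finset
open scoped Topology

namespace Literature.NumberTheory.LFunctions.NumberField

open Literature.NumberTheory.LFunctions.WeissKernel Literature.NumberTheory.LFunctions.AbelianDensity
open scoped nonZeroDivisors _root_.NumberField

variable {K : Type*} [Field K] [NumberField K]

/-! ### The class of an ideal and the class indicator -/

/-- The class of an ideal (`1` for the zero ideal). [folklore] -/
def idealClass (I : Ideal (𝓞 K)) : ClassGroup (𝓞 K) :=
  if h : I = ⊥ then 1 else ClassGroup.mk0 ⟨I, mem_nonZeroDivisors_of_ne_zero h⟩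

/-- `idealClass I = [I]` for `I ≠ 0`. [folklore] -/
theorem idealClass_of_ne_bot {I : Ideal (𝓞 K)} (hI : I ≠ ⊥) :
    idealClass I = ClassGroup.mk0 ⟨I, mem_nonZeroDivisors_of_ne_zero hI⟩ := by
  rw [idealClass, dif_neg hI]

/-- `[𝔡 𝔪] = [𝔡][𝔪]`. [folklore] -/
theorem idealClass_mul {I J : Ideal (𝓞 K)} (hI : I ≠ ⊥) (hJ : J ≠ ⊥) :
    idealClass (I * J) = idealClass I * idealClass J := by
  rw [idealClass_of_ne_bot hI, idealClass_of_ne_bot hJ, idealClass_of_ne_bot (mul_ne_zero hI hJ), ← map_mul]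
  rfl

/-- The coefficient of `L(s, χ)` at `I ≠ 0` is `χ([I])`. [folklore] -/
theorem rayClassCoeff_top_eq (χ : ClassGroup (𝓞 K) →* ℂˣ) {I : Ideal (𝓞 K)} (hI : I ≠ ⊥) :
    rayClassCoeff ⊤ (classGroupCharPrimeValue χ) I = χ (idealClass I) := by
  rw [rayClassCoeff_top_of_ne_bot χ hI, idealClass_of_ne_bot hI]

/-! ### The character sums as sums over ideals -/

/-- The weight `N𝔫^{−1} φ(u − log N𝔫)` vanishes unless `N𝔫 ≤ e^{u + (m+1)/A}`. [folklore] -/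
theorem phi_sub_log_eq_zero {A : ℝ} (hA : 0 < A) (m : ℕ) (u : ℝ) {N : ℕ}
    (hN : Real.exp (u + ((m : ℝ) + 1) / A) < N) : phi A m (u - Real.log N) = 0 := by
  refine phi_eq_zero_of_lt hA m ?_
  have hN0 : (0 : ℝ) < N := lt_trans (Real.exp_pos _) hN
  have hlog : u + ((m : ℝ) + 1) / A < Real.log N := by
    rw [← Real.exp_lt_exp, Real.exp_log hN0]; exact hN
  have hpos : 0 < ((m : ℝ) + 1) / A := by positivity
  rw [abs_sub_comm, abs_of_pos (by linarith)]
  linarith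

/-- The family `𝔫 ↦ c(𝔫) N𝔫^{−1} φ(u − log N𝔫)` has finite support (bounded norm), hence is summable.
[folklore] -/
theorem summable_mul_phi {A : ℝ} (hA : 0 < A) (m : ℕ) (u : ℝ) (c : Ideal (𝓞 K) → ℂ) :
    Summable fun I : Ideal (𝓞 K) ↦
      c I * ((Ideal.absNorm I : ℕ) : ℂ)⁻¹ * (phi A m (u - Real.log (Ideal.absNorm I)) : ℂ) := by
  refine summable_of_hasFiniteSupport ((Ideal.finite_setOf_absNorm_le (S := 𝓞 K)
    ⌊Real.exp (u + ((m : ℝ) + 1) / A)⌋₊).subset fun I hI ↦ ?_)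
  rw [Function.mem_support] at hI
  rw [Set.mem_setOf_eq]
  by_contra h
  rw [not_le] at h
  have : Real.exp (u + ((m : ℝ) + 1) / A) < Ideal.absNorm I := (Nat.floor_lt (Real.exp_pos _).le).mp h
  exact hI (by rw [phi_sub_log_eq_zero hA m u this]; simp)

/-- **The character sum over ideals**: `S_χ(u) = Σ_{𝔫 ≠ 0} χ([𝔫]) N𝔫^{−1} φ(u − log N𝔫)`
(regrouping the sum of `smoothedSum` by norms). [folklore] -/
theorem smoothedSum_classGroupCoeff_eq_tsum (χ : ClassGroup (𝓞 K) →* ℂˣ) {A : ℝ} (hA : 0 < A)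
    (m : ℕ) (u : ℝ) :
    smoothedSum (fun n ↦ ∑ I ∈ (Ideal.finite_setOf_absNorm_eq (S := 𝓞 K) n).toFinset,
        rayClassCoeff ⊤ (classGroupCharPrimeValue χ) I) A m u =
      ∑' I : Ideal (𝓞 K), rayClassCoeff ⊤ (classGroupCharPrimeValue χ) I *
        ((Ideal.absNorm I : ℕ) : ℂ)⁻¹ * (phi A m (u - Real.log (Ideal.absNorm I)) : ℂ) := by
  have h := (summable_mul_phi hA m u (rayClassCoeff ⊤ (classGroupCharPrimeValue χ))).hasSum.tsum_fiberwise
    (Ideal.absNorm : Ideal (𝓞 K) → ℕ)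
  rw [smoothedSum, ← h.tsum_eq]
  refine tsum_congr fun n ↦ ?_
  rw [eq_comm, tsum_absNorm_fiber_eq_sum (fun I : Ideal (𝓞 K) ↦ rayClassCoeff ⊤ (classGroupCharPrimeValue χ) I *
    ((Ideal.absNorm I : ℕ) : ℂ)⁻¹ * (phi A m (u - Real.log (Ideal.absNorm I)) : ℂ)) n,
    Finset.sum_mul, Finset.sum_mul]
  refine Finset.sum_congr rfl fun I hI ↦ ?_
  rw [Set.Finite.mem_toFinset, Set.mem_setOf_eq] at hI
  rw [hI]

/-! ### Class sums -/

variable (K) in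
/-- **The smoothed sum over an ideal class**: `S_C(u) = Σ_{𝔫 ∈ C} N𝔫^{−1} φ_{m+1}(u − log N𝔫)`.
[cite: ThornerZaman2017, Corollary 4.5] -/
def classSmoothedSum (C : ClassGroup (𝓞 K)) (A : ℝ) (m : ℕ) (u : ℝ) : ℂ :=
  letI := Classical.propDecidable
  ∑' I : Ideal (𝓞 K), (if I ≠ ⊥ ∧ idealClass I = C then (1 : ℂ) else 0) *
    ((Ideal.absNorm I : ℕ) : ℂ)⁻¹ * (phi A m (u - Real.log (Ideal.absNorm I)) : ℂ)

/-- `h · 𝟙[D = 1] · w = (Σ_ψ ψ(D)) · w`, a reshaping of orthogonality. [folklore] -/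
theorem sum_classGroupChar_apply_eq_ite_mul (D : ClassGroup (𝓞 K)) (w : ℂ) [Decidable (D = 1)] :
    (∑ ψ : AddChar (Additive (ClassGroup (𝓞 K))) ℂ, ψ (Additive.ofMul D)) * w =
      (Fintype.card (ClassGroup (𝓞 K)) : ℂ) * ((if D = 1 then (1 : ℂ) else 0) * w) := by
  rw [sum_classGroupChar_apply_eq_ite]
  split_ifs <;> ring

/-- **Orthogonality**: `h · S_C(u) = Σ_ψ ψ(C⁻¹) S_ψ(u)` over the characters `ψ` of `Cl_K`.
[cite: ThornerZaman2017, §4B] -/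
theorem card_mul_classSmoothedSum_eq (C : ClassGroup (𝓞 K)) {A : ℝ} (hA : 0 < A) (m : ℕ) (u : ℝ) :
    (Fintype.card (ClassGroup (𝓞 K)) : ℂ) * classSmoothedSum K C A m u =
      ∑ ψ : AddChar (Additive (ClassGroup (𝓞 K))) ℂ, ψ (Additive.ofMul C⁻¹) *
        ∑' I : Ideal (𝓞 K), rayClassCoeff ⊤ (classGroupCharPrimeValue (toMulHom ψ).toHomUnits) I *
          ((Ideal.absNorm I : ℕ) : ℂ)⁻¹ * (phi A m (u - Real.log (Ideal.absNorm I)) : ℂ) := by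
  classical
  rw [classSmoothedSum, ← tsum_mul_left]
  simp_rw [← tsum_mul_left]
  rw [← Summable.tsum_finsetSum (fun ψ _ ↦ (summable_mul_phi hA m u _).mul_left _)]
  refine tsum_congr fun I ↦ ?_
  set w : ℂ := ((Ideal.absNorm I : ℕ) : ℂ)⁻¹ * (phi A m (u - Real.log (Ideal.absNorm I)) : ℂ) with hw
  by_cases hI : I = ⊥
  · subst hI
    simp [rayClassCoeff_bot]
  · have hPQ : (I ≠ ⊥ ∧ idealClass I = C) ↔ (C⁻¹ * idealClass I = 1) :=
      ⟨fun h ↦ inv_mul_eq_one.mpr h.2.symm, fun h ↦ ⟨hI, (inv_mul_eq_one.mp h).symm⟩⟩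
    simp only [mul_assoc]
    rw [← hw]
    simp only [hPQ]
    rw [← sum_classGroupChar_apply_eq_ite_mul (K := K) (C⁻¹ * idealClass I) w, Finset.sum_mul]
    refine Finset.sum_congr rfl fun ψ _ ↦ ?_
    rw [rayClassCoeff_top_eq _ hI, toHomUnits_toMulHom_apply, ofMul_mul, AddChar.map_add_eq_mul]
    ring

/-- **The class sum is `κ_K/h` up to the error of Lemma 4.4**: for `m ≥ n_K + 3` and every real `u`,
`|S_C(u) − E(1)| ≤ (1/3)|d_K|e^{2n_K} C e^{−3u/2}`, where `E(1) = Z₁(1)/h` is the class-independent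
residue of the partial zeta functions (`κ_K/h`). [cite: ThornerZaman2017, Corollary 4.5] -/
theorem norm_classSmoothedSum_sub_le (C : ClassGroup (𝓞 K)) {A : ℝ} (hA : 0 < A) {m : ℕ}
    (hm : Module.finrank ℚ K + 3 ≤ m) (u : ℝ) :
    ‖classSmoothedSum K C A m u -
        classTwistedZeta₁ K (fun _ ↦ (1 : ℂ)) 1 / Fintype.card (ClassGroup (𝓞 K))‖ ≤
      1 / 3 * (((NumberField.discr K).natAbs : ℝ) * Real.exp (2 * Module.finrank ℚ K)) *
        majorConst A m (Module.finrank ℚ K + 1) * Real.exp (-(3 / 2 * u)) := by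
  classical
  set h : ℕ := Fintype.card (ClassGroup (𝓞 K)) with hh
  have hh0 : (h : ℂ) ≠ 0 := by
    rw [hh]; exact_mod_cast Fintype.card_ne_zero
  have hhpos : (0 : ℝ) < h := by rw [hh]; exact_mod_cast Fintype.card_pos
  set err : ℝ := 1 / 3 * (((NumberField.discr K).natAbs : ℝ) * Real.exp (2 * Module.finrank ℚ K)) *
    majorConst A m (Module.finrank ℚ K + 1) * Real.exp (-(3 / 2 * u)) with herr
  -- per character: `S_ψ(u) − Z₁_ψ(1)`
  set E : AddChar (Additive (ClassGroup (𝓞 K))) ℂ → ℂ := fun ψ ↦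
    (∑' I : Ideal (𝓞 K), rayClassCoeff ⊤ (classGroupCharPrimeValue (toMulHom ψ).toHomUnits) I *
        ((Ideal.absNorm I : ℕ) : ℂ)⁻¹ * (phi A m (u - Real.log (Ideal.absNorm I)) : ℂ)) -
      classTwistedZeta₁ K (fun C ↦ (((toMulHom ψ).toHomUnits C : ℂˣ) : ℂ)) 1 with hE
  have hEle : ∀ ψ, ‖E ψ‖ ≤ err := by
    intro ψ
    rw [hE]; dsimp only
    rw [← smoothedSum_classGroupCoeff_eq_tsum _ hA]
    exact norm_smoothedClassSum_sub_le _ hA hm u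
  -- `Σ_ψ ψ(C⁻¹) Z₁_ψ(1) = Z₁_1(1)` (only the trivial character contributes)
  have hmain : ∑ ψ : AddChar (Additive (ClassGroup (𝓞 K))) ℂ, ψ (Additive.ofMul C⁻¹) *
      classTwistedZeta₁ K (fun C ↦ (((toMulHom ψ).toHomUnits C : ℂˣ) : ℂ)) 1 =
      classTwistedZeta₁ K (fun _ ↦ (1 : ℂ)) 1 := by
    rw [Finset.sum_eq_single (0 : AddChar (Additive (ClassGroup (𝓞 K))) ℂ)]
    · simp only [AddChar.zero_apply, one_mul]
      rfl
    · intro ψ _ hψ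
      have hne : (toMulHom ψ).toHomUnits ≠ 1 := by
        intro h1
        apply hψ
        refine toHomUnits_toMulHom_injective (K := K) ?_
        show (toMulHom ψ).toHomUnits = (toMulHom 0).toHomUnits
        rw [h1]
        refine MonoidHom.ext fun C ↦ Units.ext ?_
        rw [toHomUnits_toMulHom_apply]; simp
      rw [classTwistedZeta₁_one_eq_zero hne, mul_zero]
    · intro h; exact absurd (Finset.mem_univ _) h
  -- assemble: `h (S_C − Z₁(1)/h) = Σ_ψ ψ(C⁻¹) E ψ`
  have hkey : (h : ℂ) * (classSmoothedSum K C A m u - classTwistedZeta₁ K (fun _ ↦ (1 : ℂ)) 1 / h) =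
      ∑ ψ : AddChar (Additive (ClassGroup (𝓞 K))) ℂ, ψ (Additive.ofMul C⁻¹) * E ψ := by
    rw [mul_sub, card_mul_classSmoothedSum_eq C hA m u, mul_div_cancel₀ _ hh0, ← hmain, ← Finset.sum_sub_distrib]
    refine Finset.sum_congr rfl fun ψ _ ↦ ?_
    rw [hE]; ring
  have hnorm : ‖(h : ℂ) * (classSmoothedSum K C A m u - classTwistedZeta₁ K (fun _ ↦ (1 : ℂ)) 1 / h)‖ ≤
      h * err := by
    rw [hkey]
    refine (norm_sum_le _ _).trans ?_
    calc ∑ ψ : AddChar (Additive (ClassGroup (𝓞 K))) ℂ, ‖ψ (Additive.ofMul C⁻¹) * E ψ‖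
        ≤ ∑ _ψ : AddChar (Additive (ClassGroup (𝓞 K))) ℂ, err := by
          refine Finset.sum_le_sum fun ψ _ ↦ ?_
          rw [norm_mul, AddChar.norm_apply, one_mul]
          exact hEle ψ
      _ = h * err := by
          rw [Finset.sum_const, nsmul_eq_mul, Finset.card_univ, card_addChar_classGroup, hh]
          rfl
  rw [norm_mul, Complex.norm_natCast] at hnorm
  exact le_of_mul_le_mul_left hnorm hhpos

/-! ### Sums over the multiples of an ideal in a class -/

/-- **`𝔫 = 𝔡𝔪`: the smoothed sum over the multiples of `𝔡 ≠ 0` in the class `C` is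
`N𝔡^{−1} S_{C[𝔡]⁻¹}(u − log N𝔡)`** (the map `𝔪 ↦ 𝔡𝔪` is a bijection onto the multiples of `𝔡`,
`N(𝔡𝔪) = N𝔡 N𝔪`, `[𝔡𝔪] = [𝔡][𝔪]`). [cite: ThornerZaman2017, Corollary 4.5] -/
theorem tsum_dvd_class_eq {𝔡 : Ideal (𝓞 K)} (h𝔡 : 𝔡 ≠ ⊥) (C : ClassGroup (𝓞 K)) {A : ℝ}
    (m : ℕ) (u : ℝ) [∀ I : Ideal (𝓞 K), Decidable (𝔡 ∣ I ∧ I ≠ ⊥ ∧ idealClass I = C)] :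
    ∑' I : Ideal (𝓞 K), (if 𝔡 ∣ I ∧ I ≠ ⊥ ∧ idealClass I = C then (1 : ℂ) else 0) *
        ((Ideal.absNorm I : ℕ) : ℂ)⁻¹ * (phi A m (u - Real.log (Ideal.absNorm I)) : ℂ) =
      ((Ideal.absNorm 𝔡 : ℕ) : ℂ)⁻¹ *
        classSmoothedSum K (C * (idealClass 𝔡)⁻¹) A m (u - Real.log (Ideal.absNorm 𝔡)) := by
  classical
  set f : Ideal (𝓞 K) → ℂ := fun I ↦ (if 𝔡 ∣ I ∧ I ≠ ⊥ ∧ idealClass I = C then (1 : ℂ) else 0) *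
    ((Ideal.absNorm I : ℕ) : ℂ)⁻¹ * (phi A m (u - Real.log (Ideal.absNorm I)) : ℂ) with hf
  have hinj : Function.Injective fun J : Ideal (𝓞 K) ↦ 𝔡 * J :=
    mul_right_injective₀ (by rwa [Ne, Submodule.zero_eq_bot])
  have hsupp : Function.support f ⊆ Set.range fun J : Ideal (𝓞 K) ↦ 𝔡 * J := by
    intro I hI
    rw [Function.mem_support, hf] at hI
    by_contra hr
    apply hI
    dsimp only
    rw [if_neg, zero_mul, zero_mul]
    rintro ⟨⟨J, hJ⟩, -, -⟩
    exact hr ⟨J, hJ.symm⟩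
  rw [show (∑' I : Ideal (𝓞 K), (if 𝔡 ∣ I ∧ I ≠ ⊥ ∧ idealClass I = C then (1 : ℂ) else 0) *
      ((Ideal.absNorm I : ℕ) : ℂ)⁻¹ * (phi A m (u - Real.log (Ideal.absNorm I)) : ℂ)) = ∑' I, f I from rfl,
    ← hinj.tsum_eq hsupp, classSmoothedSum, ← tsum_mul_left]
  refine tsum_congr fun J ↦ ?_
  have hN𝔡 : (0 : ℝ) < (Ideal.absNorm 𝔡 : ℕ) := by
    exact_mod_cast Nat.pos_of_ne_zero (mt Ideal.absNorm_eq_zero_iff.mp h𝔡)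
  by_cases hJ : J = ⊥
  · subst hJ
    simp [hf]
  · have hNJ : (0 : ℝ) < (Ideal.absNorm J : ℕ) := by
      exact_mod_cast Nat.pos_of_ne_zero (mt Ideal.absNorm_eq_zero_iff.mp hJ)
    have hcond : (𝔡 ∣ 𝔡 * J ∧ 𝔡 * J ≠ ⊥ ∧ idealClass (𝔡 * J) = C) ↔
        (J ≠ ⊥ ∧ idealClass J = C * (idealClass 𝔡)⁻¹) := by
      rw [idealClass_mul h𝔡 hJ]
      constructor
      · rintro ⟨-, -, h3⟩
        exact ⟨hJ, by rw [← h3, mul_comm (idealClass 𝔡) (idealClass J), mul_inv_cancel_right]⟩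
      · rintro ⟨-, h2⟩
        exact ⟨dvd_mul_right _ _, mul_ne_zero h𝔡 hJ, by rw [h2, mul_comm C _, mul_inv_cancel_left]⟩
    rw [hf]; dsimp only
    rw [if_congr hcond rfl rfl, map_mul, Nat.cast_mul, Nat.cast_mul, Real.log_mul hN𝔡.ne' hNJ.ne',
      mul_inv, show u - (Real.log (Ideal.absNorm 𝔡 : ℕ) + Real.log (Ideal.absNorm J : ℕ)) =
        u - Real.log (Ideal.absNorm 𝔡 : ℕ) - Real.log (Ideal.absNorm J : ℕ) by ring]
    ring

/-- **Thorner–Zaman Corollary 4.5 for the class group**: for `𝔡 ≠ 0`, a class `C`, `m ≥ n_K + 3`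
and every real `u`,
`|Σ_{𝔫 ∈ C, 𝔡 ∣ 𝔫} N𝔫^{−1} φ(u − log N𝔫) − E(1)/N𝔡| ≤ (1/3)|d_K|e^{2n_K} C e^{−3u/2} (N𝔡)^{1/2}`,
`E(1) = Z₁(1)/h = κ_K/h`. [cite: ThornerZaman2017, Corollary 4.5] -/
theorem norm_tsum_dvd_class_sub_le {𝔡 : Ideal (𝓞 K)} (h𝔡 : 𝔡 ≠ ⊥) (C : ClassGroup (𝓞 K)) {A : ℝ}
    (hA : 0 < A) {m : ℕ} (hm : Module.finrank ℚ K + 3 ≤ m) (u : ℝ)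
    [∀ I : Ideal (𝓞 K), Decidable (𝔡 ∣ I ∧ I ≠ ⊥ ∧ idealClass I = C)] :
    ‖(∑' I : Ideal (𝓞 K), (if 𝔡 ∣ I ∧ I ≠ ⊥ ∧ idealClass I = C then (1 : ℂ) else 0) *
        ((Ideal.absNorm I : ℕ) : ℂ)⁻¹ * (phi A m (u - Real.log (Ideal.absNorm I)) : ℂ)) -
        classTwistedZeta₁ K (fun _ ↦ (1 : ℂ)) 1 / Fintype.card (ClassGroup (𝓞 K)) / (Ideal.absNorm 𝔡 : ℕ)‖ ≤
      1 / 3 * (((NumberField.discr K).natAbs : ℝ) * Real.exp (2 * Module.finrank ℚ K)) *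
        majorConst A m (Module.finrank ℚ K + 1) * Real.exp (-(3 / 2 * u)) *
          Real.sqrt (Ideal.absNorm 𝔡 : ℕ) := by
  have hN : (0 : ℝ) < (Ideal.absNorm 𝔡 : ℕ) := by
    exact_mod_cast Nat.pos_of_ne_zero (mt Ideal.absNorm_eq_zero_iff.mp h𝔡)
  have hNC : ((Ideal.absNorm 𝔡 : ℕ) : ℂ) ≠ 0 := by exact_mod_cast hN.ne'
  rw [tsum_dvd_class_eq h𝔡 C m u]
  have e : ((Ideal.absNorm 𝔡 : ℕ) : ℂ)⁻¹ *
      classSmoothedSum K (C * (idealClass 𝔡)⁻¹) A m (u - Real.log (Ideal.absNorm 𝔡)) -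
      classTwistedZeta₁ K (fun _ ↦ (1 : ℂ)) 1 / Fintype.card (ClassGroup (𝓞 K)) / (Ideal.absNorm 𝔡 : ℕ) =
      ((Ideal.absNorm 𝔡 : ℕ) : ℂ)⁻¹ *
        (classSmoothedSum K (C * (idealClass 𝔡)⁻¹) A m (u - Real.log (Ideal.absNorm 𝔡)) -
          classTwistedZeta₁ K (fun _ ↦ (1 : ℂ)) 1 / Fintype.card (ClassGroup (𝓞 K))) := by
    field_simp
  rw [e, norm_mul, norm_inv, Complex.norm_natCast]
  have h := norm_classSmoothedSum_sub_le (C * (idealClass 𝔡)⁻¹) hA hm (u - Real.log (Ideal.absNorm 𝔡))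
  refine (mul_le_mul_of_nonneg_left h (by positivity)).trans (le_of_eq ?_)
  -- `e^{−3(u − log N)/2}/N = e^{−3u/2} √N`
  have hexp : Real.exp (-(3 / 2 * (u - Real.log (Ideal.absNorm 𝔡 : ℕ)))) =
      Real.exp (-(3 / 2 * u)) * ((Ideal.absNorm 𝔡 : ℕ) : ℝ) * Real.sqrt (Ideal.absNorm 𝔡 : ℕ) := by
    rw [show -(3 / 2 * (u - Real.log (Ideal.absNorm 𝔡 : ℕ))) =
      -(3 / 2 * u) + Real.log (Ideal.absNorm 𝔡 : ℕ) + (1 / 2) * Real.log (Ideal.absNorm 𝔡 : ℕ) by ring,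
      Real.exp_add, Real.exp_add, Real.exp_log hN, Real.sqrt_eq_rpow, Real.rpow_def_of_pos hN]
    ring_nf
  rw [hexp]
  field_simp

end Literature.NumberTheory.LFunctions.NumberField

end
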